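import Literature.AnabelianGeometry.AbsoluteAnabelian.AnabCategory
import Literature.AnabelianGeometry.AbsoluteAnabelian.AbsTopIII.TopGroupObjNonVacuity
import HarnessLib

/-!
# [AbsTopIII] Def 3.1 (vi): the category `Anab` is inhabited exactly when `𝒯𝒢^sB` is — §4(iii) NON-VACUITY
# criterion (abc-iut-w5-d197, gen 2)

S. Mochizuki, *Topics in absolute anabelian geometry III* (2015) [AbsTopIII], Def 3.1 (vi) p. 70: the
category `Anab` of pairs `(Π, A(Π))`, typed by abc-iut-L4 as `Anab (A : TG ⥤ D)` with the natural functor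
`κ_An : TG ⥤ Anab A` (`AnabCategory.lean`).  The inhabitation census counts only `∃`/`Nonempty`/head
producers, so the FUNCTOR `κAn` is invisible to it and the row `Anab` read ZERO in v1–v3.  This PROOF-ONLY
file (no `def`/`instance`/`structure`) records the exact criterion and a genuine instance:

* `Anab.nonempty_iff` — `Anab A` is inhabited iff `TG` is (objects of `Anab A` are the values of `κ_An`);
* `Anab.exists_of_obj` — every `Π : TG` gives the object `(Π, A(Π))`;
* `Anab.nonempty_topGroupObj` — GENUINE instance: with `TG :=` abc-iut-L4's `AbsTopIII.TopGroupObj`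
  (inhabited by `G_{ℚ_p}`, `TopGroupObj.exists_absoluteGaloisGroup`, file `TopGroupObjNonVacuity`) and ANY
  algorithm functor `A`, `Anab A` is inhabited.

No side taken on [IUTchIII] Cor 3.12; a witness is consistency evidence, not an endorsement; typed ≠ proved.
-/

namespace Literature.AnabelianGeometry.AbsoluteAnabelian

open _root_.CategoryTheory

universe v v' u u'

variable {TG : Type u} [Category.{v} TG] {D : Type u'} [Category.{v'} D]

/-- **[AbsTopIII] Def 3.1 (vi)** — every `Π ∈ Ob(𝒯𝒢^sB)` gives the object `κ_An(Π) = (Π, A(Π))` of `Anab`.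
[cite: MochizukiAbsTopIII2015, Definition 3.1 (vi) p.70] -/
theorem Anab.exists_of_obj (A : TG ⥤ D) (G : TG) : ∃ X : Anab A, X.grp = G ∧ X.data = A.obj G :=
  ⟨(Anab.κAn A).obj G, rfl, rfl⟩

/-- **[AbsTopIII] Def 3.1 (vi) — exact inhabitation criterion**: `Anab A` is inhabited iff `𝒯𝒢^sB` is.
[cite: MochizukiAbsTopIII2015, Definition 3.1 (vi) p.70] -/
theorem Anab.nonempty_iff (A : TG ⥤ D) : Nonempty (Anab A) ↔ Nonempty TG :=
  ⟨fun ⟨X⟩ => ⟨X.grp⟩, fun ⟨G⟩ => ⟨(Anab.κAn A).obj G⟩⟩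

/-- GENUINE instance: over abc-iut-L4's `𝒯𝒢 := AbsTopIII.TopGroupObj` (inhabited by `G_{ℚ_p}`) and any
algorithm functor `A`, the category `Anab A` has an object. [cite: MochizukiAbsTopIII2015, Definition 3.1 (vi) p.70] -/
theorem Anab.nonempty_topGroupObj {D' : Type u'} [Category.{v'} D']
    (A : AbsTopIII.TopGroupObj ⥤ D') : Nonempty (Anab A) :=
  (Anab.nonempty_iff A).2 AbsTopIII.TopGroupObj.nonempty_model

end Literature.AnabelianGeometry.AbsoluteAnabelian
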